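import Literature.Geometry.GeometricMeasureTheory.BlowUpSheetMultiplicity
import Literature.Geometry.GeometricMeasureTheory.BlowUpGoodPoints
import HarnessLib

/-!
# The blow-up limit at a good point is the tangent plane with multiplicity one

Support file for the proof of the named fact
`Literature.Geometry.GeometricMeasureTheory.Federer1969_compactness_integralCurrents` along
B. White's structure-theorem-free proof of the closure theorem, end of Step 3 and Step 4 of
[White1989, pp. 219–220] ("To avoid contradiction … we must have `p = 1` and `α₁ = 1` … `P` is the
approximate tangent plane of `M` at `a`"; [Bandara2006, proof of Thm. 4.2.1, pp. 44–45,
Lemma 4.1.13]). Setting of `BlowUpCycle`/`BlowUpGoodPoints`: `σ` finite carried by `M` with the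
projection hypothesis `𝓗^{k+1}(P_W A) ≤ σ(A)` (`A ⊆ M`, `dim W = k + 1`), `T = σ ∧ ξ` a cycle, `a`
a good point (normalised Lebesgue point of `ξ`, density point of a lower-density set, `ξ(a) ≠ 0`,
`Θ^{*(k+1)}(σ, a) ≤ 1`), and `σ_{a,λ_l} → ν` vaguely.

* `volume_ball_eq_unitBallVolume_mul` — `vol_W(B(0, R)) = α(k+1) R^{k+1}` on a `(k+1)`-plane;
* `eventually_le_blowUp_closedBall`, `zero_mem_support_blowUpLimit` — `0 ∈ spt ν`;
* `sum_sheetMultiplicity_mul_volume_le` — for finitely many sheets `z` (points of `spt ν ∩ Wᗮ`,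
  `ν ⌞ slab_z = α_z 𝓗^{k+1} ⌞ (z + W)`) within distance `ρ` of `0`:
  `(Σ α_z) vol_W(B(0,R)) ≤ ν(B(0, R + ρ))` (the planes `z + W` are disjoint and the cylinder over
  `B_W(0,R)` of height `ρ` lies in `B(0, R + ρ)`), hence with the sharp growth
  `ν(B(0, R')) ≤ α(k+1) R'^{k+1}` (`blowUpLimit_ball_le`): `Σ α_z ≤ 1`
  (`sum_sheetMultiplicity_le_one`, letting `R → ∞`) [Bandara2006, Lemmas 4.1.10, 4.1.13];
* **`blowUpLimit_eq_restrict_invariantSubspace`** — since every `α_z ≥ 1`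
  (`one_le_sheetMultiplicity`) and `0` is a sheet, `spt ν ∩ Wᗮ = {0}`, `α_0 = 1`, and
  `ν = 𝓗^{k+1} ⌞ W_{ξ(a)}` with `dim W_{ξ(a)} = k + 1`: THE BLOW-UP IS UNIQUE;
* `exists_subseq_vagueTendsto_restrict_invariantSubspace`, `vagueTendsto_blowUp_of_good` — hence
  the full blow-up sequence converges: for every `λ_l ↓ 0`, `σ_{a,λ_l} → 𝓗^{k+1} ⌞ W_{ξ(a)}` vaguely
  (subsequence principle, `exists_subseq_vagueTendsto_blowUp`);
* `tendsto_blowUp_coneCompl_of_good` (with `image_add_smul_coneCompl`) — and the **approximate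
  tangent plane property**: for every `s > 0`,
  `r^{-(k+1)} σ{x ∈ 𝐁(a,r) : s‖x − a‖ ≤ ‖P_{Wᗮ}(x − a)‖} → 0` as `r ↓ 0` (the complement of the cone
  `X(a, W, s)` has density zero; Mattila's criterion 15.19 is fed with this in
  `RectifiabilityCriterion`).

Theorems only; no definitions, no named facts.

## References

* B. White, *A new proof of the compactness theorem for integral currents*, Comment. Math.
  Helv. 64 (1989) 207–220, pp. 219–220 [White1989].
* L. Bandara, *The closure theorem for integral currents without the structure theorem*,
  B.Sc. thesis, ANU 2006, Lemmas 4.1.10, 4.1.13, proof of Thm. 4.2.1, pp. 44–45 (held copy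
  `lit paper:galaxy-pdf-8023002039701172160`) [Bandara2006].
* P. Mattila, *Geometry of Sets and Measures in Euclidean Spaces*, CUP 1995, 15.19 [Mattila1995].
-/

noncomputable section

open scoped Distributions ENNReal NNReal Topology ContDiff RealInnerProductSpace Pointwise
open MeasureTheory TopologicalSpace Set Filter Metric Function

namespace Literature.Geometry.GeometricMeasureTheory

-- Nested operator-norm instances on (duals of) `E [⋀^Fin m]→L[ℝ] ℝ`, as in `Currents.lean`.
set_option maxSynthPendingDepth 3

variable {V : Type*} [NormedAddCommGroup V] [InnerProductSpace ℝ V] [FiniteDimensional ℝ V]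
  [MeasurableSpace V] [BorelSpace V] {k : ℕ}

/-! ### Volume of balls in a `(k+1)`-plane -/

section Volume

/-- **`vol_W(B(0, R)) = α(k+1) R^{k+1}`** for a subspace `W` of dimension `k + 1`
(`α(k+1) = unitBallVolume (k+1)`, the volume of the unit ball of `ℝ^{k+1}`; transport along an
orthonormal basis). [cite: Federer1969, 2.7.16 (1)] -/
theorem volume_ball_eq_unitBallVolume_mul (W : Submodule ℝ V)
    (hdim : Module.finrank ℝ W = k + 1) {R : ℝ} (hR : 0 ≤ R) :
    (volume : Measure W) (ball (0 : W) R) = unitBallVolume (k + 1) * ENNReal.ofReal (R ^ (k + 1)) := by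
  haveI : Nontrivial W := Module.nontrivial_of_finrank_eq_succ hdim
  set e : OrthonormalBasis (Fin (k + 1)) ℝ W := (stdOrthonormalBasis ℝ W).reindex (finCongr hdim)
    with he
  have h1 : (volume : Measure W) (ball (0 : W) 1) =
      volume (ball (0 : EuclideanSpace ℝ (Fin (k + 1))) 1) := by
    have hmp := e.repr.symm.measurePreserving
    rw [← hmp.measure_preimage measurableSet_ball.nullMeasurableSet]
    congr 1
    ext x
    simp
  rw [Measure.addHaar_ball volume (0 : W) hR, hdim, h1, unitBallVolume, mul_comm]

/-- `𝓗^{k+1} ⌞ W` is locally finite for a `(k+1)`-plane `W` (it is Lebesgue measure of `W`).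
[cite: Federer1969, 2.10.35] -/
theorem isLocallyFiniteMeasure_restrict_submodule (W : Submodule ℝ V)
    (hdim : Module.finrank ℝ W = k + 1) :
    IsLocallyFiniteMeasure ((μHE[k + 1] : Measure V).restrict W) := by
  refine ⟨fun x => ⟨closedBall x 1, closedBall_mem_nhds x one_pos, ?_⟩⟩
  set P := W.orthogonalProjectionOnto with hPdef
  have hsub : closedBall x 1 ∩ (W : Set V) ⊆
      P ⁻¹' closedBall (P x) 1 ∩ {y : V | y - 0 ∈ W} := by
    rintro y ⟨hy, hyW⟩
    refine ⟨?_, by simpa using hyW⟩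
    rw [mem_preimage, mem_closedBall, dist_eq_norm, ← map_sub]
    exact ((P.le_opNorm _).trans (mul_le_of_le_one_left (norm_nonneg _)
      (Submodule.orthogonalProjectionOnto_norm_le W))).trans (mem_closedBall_iff_norm.1 hy)
  rw [Measure.restrict_apply measurableSet_closedBall]
  calc (μHE[k + 1] : Measure V) (closedBall x 1 ∩ W)
      ≤ (μHE[k + 1] : Measure V) (P ⁻¹' closedBall (P x) 1 ∩ {y : V | y - 0 ∈ W}) := measure_mono hsub
    _ = (μHE[k + 1] : Measure V).restrict {y : V | y - 0 ∈ W} (P ⁻¹' closedBall (P x) 1) :=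
        (Measure.restrict_apply (measurableSet_closedBall.preimage P.continuous.measurable)).symm
    _ = volume (closedBall (P x) 1) :=
        euclideanHausdorffMeasure_restrict_plane_preimage W hdim (Submodule.zero_mem _)
          measurableSet_closedBall
    _ < ⊤ := measure_closedBall_lt_top

end Volume

/-! ### `0` is a point of the support of the blow-up limit -/

section Support

variable {σ : Measure V} {ξ : V → Multivector V (k + 1)} {a : V} {lam : ℕ → ℝ} {ν : Measure V}

omit [FiniteDimensional ℝ V] in
/-- **Mass of the blow-ups near the origin**: at a normalised Lebesgue point `a` of `ξ` with
`ξ(a) ≠ 0` where the lower density bound `(βr)^{k+1} ≤ ∫_{𝐁(a,r)} ‖ξ‖ dσ` holds for small `r`, for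
every `R > 0`, eventually `σ_{a,λ_l}(𝐁(0, R)) ≥ (βR)^{k+1} / (2‖ξ(a)‖)`.
[cite: White1989, p. 217; Bandara2006, Lemma 4.1.5] -/
theorem eventually_le_blowUp_closedBall [IsFiniteMeasure σ] (hξ : Integrable ξ σ)
    (hlam : ∀ l, 0 < lam l) (hlam0 : Tendsto lam atTop (𝓝 0))
    (hLeb : Tendsto (fun r => (r⁻¹) ^ (k + 1) * ∫ x in closedBall a r, ‖ξ x - ξ a‖ ∂σ)
      (𝓝[>] 0) (𝓝 0)) {β : ℝ} (hβ : 0 < β)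
    (hAa : ∀ᶠ r in 𝓝[>] (0 : ℝ), (β * r) ^ (k + 1) ≤ ∫ x' in closedBall a r, ‖ξ x'‖ ∂σ)
    (hξa : ξ a ≠ 0) {R : ℝ} (hR : 0 < R) :
    ∀ᶠ l in atTop, ENNReal.ofReal ((β * R) ^ (k + 1) / (2 * ‖ξ a‖)) ≤
      Measure.blowUp σ (k + 1) a (lam l) (closedBall 0 R) := by
  have hξa' : 0 < ‖ξ a‖ := norm_pos_iff.2 hξa
  have hξ' : Integrable (fun x => ξ x - ξ a) σ := hξ.sub (integrable_const _)
  -- radii `λ_l R ↓ 0`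
  have hcomp : Tendsto (fun l => lam l * R) atTop (𝓝[>] 0) :=
    tendsto_nhdsWithin_iff.2 ⟨by simpa using hlam0.mul_const R,
      Eventually.of_forall fun l => mul_pos (hlam l) hR⟩
  have e1 : ∀ᶠ l in atTop, (β * (lam l * R)) ^ (k + 1) ≤
      ∫ x' in closedBall a (lam l * R), ‖ξ x'‖ ∂σ := hcomp.eventually hAa
  -- the Lebesgue-point error is eventually `≤ (β^{k+1}/2) (λ_l R)^{k+1}`
  have e2 : ∀ᶠ l in atTop, ∫ x in closedBall a (lam l * R), ‖ξ x - ξ a‖ ∂σ ≤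
      (β ^ (k + 1) / 2) * (lam l * R) ^ (k + 1) := by
    have hc : (0 : ℝ) < β ^ (k + 1) / 2 := by positivity
    have h := (hLeb.comp hcomp).eventually (Iic_mem_nhds hc)
    filter_upwards [h] with l hl
    simp only [comp_apply] at hl
    have htp : 0 < (lam l * R) ^ (k + 1) := pow_pos (mul_pos (hlam l) hR) _
    calc ∫ x in closedBall a (lam l * R), ‖ξ x - ξ a‖ ∂σ
        = (lam l * R) ^ (k + 1) * (((lam l * R)⁻¹) ^ (k + 1) *
            ∫ x in closedBall a (lam l * R), ‖ξ x - ξ a‖ ∂σ) := by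
          rw [← mul_assoc, ← mul_pow, mul_inv_cancel₀ (mul_pos (hlam l) hR).ne', one_pow, one_mul]
      _ ≤ (lam l * R) ^ (k + 1) * (β ^ (k + 1) / 2) := mul_le_mul_of_nonneg_left hl htp.le
      _ = (β ^ (k + 1) / 2) * (lam l * R) ^ (k + 1) := mul_comm _ _
  filter_upwards [e1, e2] with l h1 h2
  have ht := hlam l
  set S : Set V := closedBall a (lam l * R) with hS
  have h7 : ∫ x' in S, ‖ξ x'‖ ∂σ ≤ ‖ξ a‖ * (σ S).toReal + ∫ x' in S, ‖ξ x' - ξ a‖ ∂σ := by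
    calc ∫ x' in S, ‖ξ x'‖ ∂σ ≤ ∫ x' in S, (‖ξ a‖ + ‖ξ x' - ξ a‖) ∂σ :=
          integral_mono hξ.norm.integrableOn
            ((integrable_const _).add hξ'.norm.integrableOn) fun x' =>
            norm_le_norm_add_norm_sub' (ξ x') (ξ a)
      _ = ‖ξ a‖ * (σ S).toReal + ∫ x' in S, ‖ξ x' - ξ a‖ ∂σ := by
          rw [integral_add (integrable_const _) hξ'.norm.integrableOn, setIntegral_const,
            smul_eq_mul, mul_comm, Measure.real]
  -- `(βλR)^{k+1}/2 ≤ ‖ξ a‖ σ(S)`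
  have h3 : (β * (lam l * R)) ^ (k + 1) / 2 ≤ ‖ξ a‖ * (σ S).toReal := by
    rw [mul_pow] at h1 ⊢
    have : β ^ (k + 1) * (lam l * R) ^ (k + 1) / 2 = β ^ (k + 1) * (lam l * R) ^ (k + 1) -
        (β ^ (k + 1) / 2) * (lam l * R) ^ (k + 1) := by ring
    linarith
  have hmain : (β * R) ^ (k + 1) / (2 * ‖ξ a‖) ≤ (lam l)⁻¹ ^ (k + 1) * (σ S).toReal := by
    rw [div_le_iff₀ (by positivity)]
    have htp : 0 < (lam l) ^ (k + 1) := pow_pos ht _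
    rw [← mul_le_mul_iff_of_pos_left htp]
    calc lam l ^ (k + 1) * ((β * R) ^ (k + 1)) = (β * (lam l * R)) ^ (k + 1) := by ring
      _ ≤ 2 * (‖ξ a‖ * (σ S).toReal) := by linarith
      _ = lam l ^ (k + 1) * ((lam l)⁻¹ ^ (k + 1) * (σ S).toReal * (2 * ‖ξ a‖)) := by
          rw [inv_pow]; field_simp
  calc ENNReal.ofReal ((β * R) ^ (k + 1) / (2 * ‖ξ a‖))
      ≤ ENNReal.ofReal ((lam l)⁻¹ ^ (k + 1) * (σ S).toReal) := ENNReal.ofReal_le_ofReal hmain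
    _ = Measure.blowUp σ (k + 1) a (lam l) (closedBall 0 R) := by
        rw [ENNReal.ofReal_mul (by positivity), ENNReal.ofReal_toReal (measure_ne_top σ _),
          Measure.blowUp_apply_closedBall σ (k + 1) a ht 0 R, smul_zero, add_zero]

/-- **`0 ∈ spt ν`**: every vague limit of blow-ups at a point with the lower density bound has the
origin in its support (`ν(𝐁(0,R)) ≥ (βR)^{k+1}/(2‖ξ(a)‖) > 0` for every `R > 0`).
[cite: White1989, p. 217; Bandara2006, p. 44] -/
theorem zero_mem_support_blowUpLimit [IsFiniteMeasure σ] [IsLocallyFiniteMeasure ν]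
    (hξ : Integrable ξ σ) (hlam : ∀ l, 0 < lam l) (hlam0 : Tendsto lam atTop (𝓝 0))
    (hv : Measure.VagueTendsto (fun l => Measure.blowUp σ (k + 1) a (lam l)) ν)
    (hLeb : Tendsto (fun r => (r⁻¹) ^ (k + 1) * ∫ x in closedBall a r, ‖ξ x - ξ a‖ ∂σ)
      (𝓝[>] 0) (𝓝 0)) {β : ℝ} (hβ : 0 < β)
    (hAa : ∀ᶠ r in 𝓝[>] (0 : ℝ), (β * r) ^ (k + 1) ≤ ∫ x' in closedBall a r, ‖ξ x'‖ ∂σ)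
    (hξa : ξ a ≠ 0) : (0 : V) ∈ ν.support := by
  rw [(nhds_basis_closedBall (x := (0 : V))).mem_measureSupport]
  intro R hR
  have hξa' : 0 < ‖ξ a‖ := norm_pos_iff.2 hξa
  have hpos : 0 < ENNReal.ofReal ((β * R) ^ (k + 1) / (2 * ‖ξ a‖)) :=
    ENNReal.ofReal_pos.2 (by positivity)
  have hev := eventually_le_blowUp_closedBall hξ hlam hlam0 hLeb hβ hAa hξa hR
  have hls : limsup (fun l => Measure.blowUp σ (k + 1) a (lam l) (closedBall 0 R)) atTop ≤
      ν (closedBall 0 R) := hv.limsup_measure_le_of_isCompact (isCompact_closedBall 0 R)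
  exact hpos.trans_le ((le_liminf_of_le (h := hev)).trans ((liminf_le_limsup (u := fun l =>
    Measure.blowUp σ (k + 1) a (lam l) (closedBall 0 R))).trans hls))

end Support

/-! ### The sheets add up to at most one -/

section Sheets

variable {ν : Measure V}

/-- **The planes of distinct sheets carry `ν`-mass additively inside a ball.** Let `ν` be a measure,
`W` a subspace of dimension `k + 1`, and `Z₀` a finite set of points `z ∈ Wᗮ` with `‖z‖ < ρ`, each
carrying a slab equation `ν ⌞ {dist(P_{Wᗮ}·, z) < δ_z} = α_z 𝓗^{k+1} ⌞ (z + W)` with `δ_z > 0`. Then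
`(Σ_{z ∈ Z₀} α_z) · vol_W(B(0, R)) ≤ ν(B(0, R + ρ))` for every `R > 0`.
[cite: Bandara2006, Lemma 4.1.10; White1989, p. 219] -/
theorem sum_sheetMultiplicity_mul_volume_le (W : Submodule ℝ V) (hdim : Module.finrank ℝ W = k + 1)
    (Z₀ : Finset V) (hZW : ∀ z ∈ Z₀, z ∈ Wᗮ) {ρ : ℝ} (hZρ : ∀ z ∈ Z₀, ‖z‖ < ρ)
    (δ : V → ℝ) (hδ : ∀ z ∈ Z₀, 0 < δ z) (α : V → ℝ≥0)
    (hsheet : ∀ z ∈ Z₀, ν.restrict {x | dist (Wᗮ.starProjection x) z < δ z} =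
      (α z : ℝ≥0∞) • (μHE[k + 1] : Measure V).restrict {x | x - z ∈ W})
    (R : ℝ) :
    (∑ z ∈ Z₀, (α z : ℝ≥0∞)) * (volume : Measure W) (ball (0 : W) R) ≤ ν (ball 0 (R + ρ)) := by
  classical
  set P := W.orthogonalProjectionOnto with hPdef
  -- the pieces `E_z = (z + W) ∩ Π⁻¹ B_W(0, R)`
  set E : V → Set V := fun z => {x : V | x - z ∈ W} ∩ P ⁻¹' ball (0 : W) R with hE
  have hAm : ∀ z : V, MeasurableSet {x : V | x - z ∈ W} := fun z => by
    have : {x : V | x - z ∈ W} = (fun x => x - z) ⁻¹' (W : Set V) := rfl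
    rw [this]
    exact (W.closed_of_finiteDimensional.preimage (continuous_id.sub continuous_const)).measurableSet
  have hEm : ∀ z, MeasurableSet (E z) := fun z =>
    (hAm z).inter (measurableSet_ball.preimage P.continuous.measurable)
  -- on `E_z` the `Wᗮ`-component is `z`
  have hPz : ∀ z ∈ Z₀, ∀ x ∈ E z, Wᗮ.starProjection x = z := by
    intro z hz x hx
    have hxz : x = z + (x - z) := by abel
    rw [hxz, map_add, Submodule.starProjection_orthogonal_apply_eq_zero hx.1, add_zero]
    exact Submodule.starProjection_eq_self_iff.2 (hZW z hz)
  -- measure of each piece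
  have hνE : ∀ z ∈ Z₀, ν (E z) = (α z : ℝ≥0∞) * (volume : Measure W) (ball (0 : W) R) := by
    intro z hz
    have hsub : E z ⊆ {x | dist (Wᗮ.starProjection x) z < δ z} := fun x hx => by
      change dist (Wᗮ.starProjection x) z < δ z
      rw [hPz z hz x hx, dist_self]; exact hδ z hz
    rw [← inter_eq_self_of_subset_left hsub, ← Measure.restrict_apply (hEm z), hsheet z hz,
      Measure.smul_apply, smul_eq_mul, Measure.restrict_apply (hEm z), hE]
    simp only
    rw [inter_assoc, inter_comm _ {x : V | x - z ∈ W}, ← inter_assoc, inter_self, inter_comm,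
      ← Measure.restrict_apply (measurableSet_ball.preimage P.continuous.measurable),
      euclideanHausdorffMeasure_restrict_plane_preimage W hdim (hZW z hz) measurableSet_ball]
  -- the pieces are disjoint and lie in `B(0, R + ρ)`
  have hdisj : Set.PairwiseDisjoint (↑Z₀ : Set V) E := by
    intro z hz z' hz' hne
    refine Set.disjoint_left.2 fun x hx hx' => hne ?_
    rw [← hPz z hz x hx, hPz z' hz' x hx']
  have hEsub : ∀ z ∈ Z₀, E z ⊆ ball (0 : V) (R + ρ) := by
    intro z hz x hx
    rw [mem_ball, dist_zero_right]
    have h1 : ‖W.starProjection x‖ < R := by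
      have := hx.2
      rw [mem_preimage, mem_ball, dist_zero_right] at this
      rwa [Submodule.starProjection_apply, Submodule.norm_coe]
    calc ‖x‖ = ‖W.starProjection x + Wᗮ.starProjection x‖ := by
          rw [Submodule.starProjection_add_starProjection_orthogonal (K := W) x]
      _ ≤ ‖W.starProjection x‖ + ‖Wᗮ.starProjection x‖ := norm_add_le _ _
      _ < R + ρ := by rw [hPz z hz x hx]; exact add_lt_add h1 (hZρ z hz)
  calc (∑ z ∈ Z₀, (α z : ℝ≥0∞)) * (volume : Measure W) (ball (0 : W) R)
      = ∑ z ∈ Z₀, ν (E z) := by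
        rw [Finset.sum_mul]
        exact Finset.sum_congr rfl fun z hz => (hνE z hz).symm
    _ = ν (⋃ z ∈ Z₀, E z) := (measure_biUnion_finset hdisj fun z _ => hEm z).symm
    _ ≤ ν (ball 0 (R + ρ)) := measure_mono (iUnion₂_subset fun z hz => hEsub z hz)

/-- **The sheet multiplicities add up to at most one** under the sharp growth bound
`ν(B(0, R')) ≤ α(k+1) R'^{k+1}` (`= vol_W(B(0, R'))`): `Σ_{z ∈ Z₀} α_z ≤ 1`
(`(Σ α_z) R^{k+1} ≤ (R + ρ)^{k+1}` for all `R`, and `R → ∞`).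
[cite: Bandara2006, Lemmas 4.1.10, 4.1.13; White1989, p. 219] -/
theorem sum_sheetMultiplicity_le_one (W : Submodule ℝ V) (hdim : Module.finrank ℝ W = k + 1)
    (Z₀ : Finset V) (hZW : ∀ z ∈ Z₀, z ∈ Wᗮ)
    (δ : V → ℝ) (hδ : ∀ z ∈ Z₀, 0 < δ z) (α : V → ℝ≥0)
    (hsheet : ∀ z ∈ Z₀, ν.restrict {x | dist (Wᗮ.starProjection x) z < δ z} =
      (α z : ℝ≥0∞) • (μHE[k + 1] : Measure V).restrict {x | x - z ∈ W})
    (hgrowth : ∀ R : ℝ, 0 < R → ν (ball 0 R) ≤ unitBallVolume (k + 1) * ENNReal.ofReal (R ^ (k + 1))) :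
    ∑ z ∈ Z₀, α z ≤ 1 := by
  classical
  -- a radius `ρ` beyond all sheets
  obtain ⟨ρ, hρ0, hZρ⟩ : ∃ ρ : ℝ, 0 < ρ ∧ ∀ z ∈ Z₀, ‖z‖ < ρ :=
    ⟨Z₀.sum (fun z => ‖z‖) + 1, by positivity, fun z hz => by
      have := Finset.single_le_sum (f := fun z => ‖z‖) (fun z _ => norm_nonneg z) hz
      linarith⟩
  set s : ℝ≥0 := ∑ z ∈ Z₀, α z with hs
  have hωtop : unitBallVolume (k + 1) ≠ ⊤ := measure_ball_lt_top.ne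
  have hω0 : unitBallVolume (k + 1) ≠ 0 := (measure_ball_pos volume _ one_pos).ne'
  -- `s R^{k+1} ≤ (R + ρ)^{k+1}` for all `R > 0`
  have hineq : ∀ R : ℝ, 0 < R → (s : ℝ≥0∞) ≤ ENNReal.ofReal (((R + ρ) / R) ^ (k + 1)) := by
    intro R hR
    have h1 := sum_sheetMultiplicity_mul_volume_le W hdim Z₀ hZW hZρ δ hδ α hsheet R
    rw [volume_ball_eq_unitBallVolume_mul W hdim hR.le] at h1
    have h2 := h1.trans (hgrowth (R + ρ) (by linarith))
    have hRk : ENNReal.ofReal (R ^ (k + 1)) ≠ 0 := (ENNReal.ofReal_pos.2 (pow_pos hR _)).ne'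
    -- divide by `α(k+1) R^{k+1}`
    have h3 : (s : ℝ≥0∞) * (unitBallVolume (k + 1) * ENNReal.ofReal (R ^ (k + 1))) ≤
        ENNReal.ofReal (((R + ρ) / R) ^ (k + 1)) *
          (unitBallVolume (k + 1) * ENNReal.ofReal (R ^ (k + 1))) := by
      have hs' : (s : ℝ≥0∞) = ∑ z ∈ Z₀, (α z : ℝ≥0∞) := by
        rw [hs, ENNReal.ofNNReal_finsetSum]
      rw [hs']
      refine h2.trans (le_of_eq ?_)
      rw [mul_comm (ENNReal.ofReal _), mul_assoc, ← ENNReal.ofReal_mul (by positivity), ← mul_pow,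
        mul_div_cancel₀ _ hR.ne']
    exact (ENNReal.mul_le_mul_iff_left (mul_ne_zero hω0 hRk)
      (ENNReal.mul_ne_top hωtop ENNReal.ofReal_ne_top)).1 h3
  -- let `R → ∞`
  have hlim : Tendsto (fun R : ℝ => ENNReal.ofReal (((R + ρ) / R) ^ (k + 1))) atTop (𝓝 1) := by
    have h1 : Tendsto (fun R : ℝ => (R + ρ) / R) atTop (𝓝 1) := by
      have : Tendsto (fun R : ℝ => 1 + ρ * R⁻¹) atTop (𝓝 (1 + ρ * 0)) :=
        tendsto_const_nhds.add (tendsto_inv_atTop_zero.const_mul ρ)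
      rw [mul_zero, add_zero] at this
      refine this.congr' ?_
      filter_upwards [eventually_gt_atTop 0] with R hR
      field_simp
    have h2 := (h1.pow (k + 1))
    rw [one_pow] at h2
    have h3 := (ENNReal.continuous_ofReal.tendsto 1).comp h2
    rwa [ENNReal.ofReal_one] at h3
  have hle : (s : ℝ≥0∞) ≤ 1 :=
    ge_of_tendsto hlim (Filter.eventually_of_mem (Ioi_mem_atTop 0) fun R hR => hineq R hR)
  exact_mod_cast hle

end Sheets

/-! ### The blow-up limit is `𝓗^{k+1} ⌞ W_{ξ(a)}` -/

section Unique

variable {σ : Measure V} {ξ : V → Multivector V (k + 1)} {a : V} {lam : ℕ → ℝ} {ν : Measure V}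
  [IsFiniteMeasure σ] [IsLocallyFiniteMeasure ν]

/-- **The blow-up limit at a good point is the tangent plane with multiplicity one**
[White1989, pp. 219–220: "we must have `p = 1` and `α₁ = 1`"; Bandara2006, pp. 44–45]. Let `σ` be
finite, carried by `M`, with the projection hypothesis `𝓗^{k+1}(P_W A) ≤ σ(A)` for `A ⊆ M` and all
`(k+1)`-planes `W`; `T = σ ∧ ξ` a cycle; `a` a good point: normalised Lebesgue point of `ξ`,
`ξ(a) ≠ 0`, the lower density bound `(βr)^{k+1} ≤ ∫_{𝐁(x,r)} ‖ξ‖ dσ` (`r ≤ r₁`) on a set `M'` containing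
`a` of which `a` is a density point, and `Θ^{*(k+1)}(σ, a) ≤ 1`. If `σ_{a,λ_l} → ν` vaguely
(`λ_l ↓ 0`), then `dim W_{ξ(a)} = k + 1` and `ν = 𝓗^{k+1} ⌞ W_{ξ(a)}`.
[cite: White1989, pp. 219–220; Bandara2006, Thm. 4.2.1] -/
theorem blowUpLimit_eq_restrict_invariantSubspace (hξ : Integrable ξ σ)
    (hT : (vectorCurrent σ ξ : Current (⊤ : Opens V) (k + 1)).boundary = 0)
    {M : Set V} (hM : σ Mᶜ = 0)
    (hproj : ∀ W : Submodule ℝ V, Module.finrank ℝ W = k + 1 →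
      ∀ A ⊆ M, (μHE[k + 1] : Measure V) (W.starProjection '' A) ≤ σ A)
    (hlam : ∀ l, 0 < lam l) (hlam0 : Tendsto lam atTop (𝓝 0))
    (hv : Measure.VagueTendsto (fun l => Measure.blowUp σ (k + 1) a (lam l)) ν)
    (hLeb : Tendsto (fun r => (r⁻¹) ^ (k + 1) * ∫ x in closedBall a r, ‖ξ x - ξ a‖ ∂σ)
      (𝓝[>] 0) (𝓝 0))
    {M' : Set V} {β r₁ : ℝ} (hβ : 0 < β) (hr₁ : 0 < r₁) (haM' : a ∈ M')
    (hM' : ∀ x ∈ M', ∀ r, 0 < r → r ≤ r₁ → (β * r) ^ (k + 1) ≤ ∫ x' in closedBall x r, ‖ξ x'‖ ∂σ)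
    (hdens : Tendsto (fun r => (r⁻¹) ^ (k + 1) * (σ (closedBall a r \ M')).toReal)
      (𝓝[>] 0) (𝓝 0))
    (hξa : ξ a ≠ 0)
    (hup : ∀ t : ℝ≥0∞, 1 < t → ∀ᶠ r in 𝓝[>] (0 : ℝ),
      σ (closedBall a r) ≤ t * (unitBallVolume (k + 1) * ENNReal.ofReal (r ^ (k + 1)))) :
    Module.finrank ℝ (ξ a).invariantSubspace = k + 1 ∧
      ν = (μHE[k + 1] : Measure V).restrict (ξ a).invariantSubspace := by
  classical
  set W := (ξ a).invariantSubspace with hWdef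
  -- lower density bound at `a` for small radii
  have hAa : ∀ᶠ r in 𝓝[>] (0 : ℝ), (β * r) ^ (k + 1) ≤ ∫ x' in closedBall a r, ‖ξ x'‖ ∂σ := by
    filter_upwards [Ioc_mem_nhdsGT hr₁] with r hr
    exact hM' a haM' r hr.1 hr.2
  -- (1) `ν ≠ 0`, uniform lower density on `spt ν`, invariance, dimension
  have hν : ν ≠ 0 := blowUpLimit_ne_zero hξ hlam hlam0 hv hLeb hβ hAa hξa
  have hξa' : 0 < ‖ξ a‖ := norm_pos_iff.2 hξa
  set c : ℝ≥0∞ := ENNReal.ofReal ((β / 2) ^ (k + 1) / ‖ξ a‖) with hc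
  have hc0 : c ≠ 0 := (ENNReal.ofReal_pos.2 (by positivity)).ne'
  have hld : ∀ y ∈ ν.support, ∀ r : ℝ, 0 < r → c * ENNReal.ofReal (r ^ (k + 1)) ≤ ν (closedBall y r) := by
    intro y hy r hr
    have h := le_blowUpLimit_closedBall hξ hlam hlam0 hv hLeb hr₁ hM' hdens hξa hy hr
    rw [hc, ← ENNReal.ofReal_mul (by positivity)]
    convert h using 2
    rw [div_pow, mul_div_assoc, mul_pow, div_pow]
    ring
  have hinv : ∀ w ∈ W, ν.map (· + w) = ν := fun w hw =>
    blowUpLimit_map_add_eq_self hξ hT hlam hlam0 hv hLeb hw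
  have hdim : Module.finrank ℝ W = k + 1 :=
    finrank_invariantSubspace_blowUpLimit hξ hT hlam hlam0 hv hLeb hξa hν hc0 hld
  refine ⟨hdim, ?_⟩
  have hld' : ∀ y ∈ ν.support, ∀ r : ℝ, 0 < r → r ≤ 1 →
      c * ENNReal.ofReal (r ^ (k + 1)) ≤ ν (closedBall y r) := fun y hy r hr _ => hld y hy r hr
  -- (2) the frame and `c₀`
  set e : OrthonormalBasis (Fin (k + 1)) ℝ W := (stdOrthonormalBasis ℝ W).reindex (finCongr hdim)
    with hedef
  have heV : Orthonormal ℝ (fun i => (e i : V)) := orthonormal_subtype_val_comp e.orthonormal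
  have heW : ∀ i, (e i : V) ∈ W := fun i => (e i).2
  have hsimple := blowUpLimit_vectorfield_eq_smul_frameVector ξ a hdim heV heW
  have hc₀ : (ξ a) (frameCovector fun i => (e i : V)) ≠ 0 := by
    intro h0
    rw [h0, zero_smul] at hsimple
    exact hξa hsimple
  -- (3) every sheet has multiplicity `≥ 1`; sheets: isolation radii and multiplicities
  have hiso : ∀ z : V, ∃ δ : ℝ, 0 < δ ∧ ∀ z' ∈ ν.support, z' ∈ Wᗮ → dist z' z < δ → z' = z :=
    fun z => Measure.exists_isolated_of_mem_support_inter_orthogonal hinv hc0 one_pos hld' hdim z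
  choose δ hδ hδiso using hiso
  have hslab : ∀ z : V, z ∈ Wᗮ → ∃ α : ℝ≥0, ν.restrict {x | dist (Wᗮ.starProjection x) z < δ z} =
      (α : ℝ≥0∞) • (μHE[k + 1] : Measure V).restrict {x | x - z ∈ W} := by
    intro z hz
    have h := Measure.exists_restrict_slab_eq_smul hinv hz (hδiso z)
    rwa [hdim] at h
  -- (4) `0` is the only sheet
  have h0spt : (0 : V) ∈ ν.support := zero_mem_support_blowUpLimit hξ hlam hlam0 hv hLeb hβ hAa hξa
  have hgrowth : ∀ R : ℝ, 0 < R → ν (ball 0 R) ≤ unitBallVolume (k + 1) * ENNReal.ofReal (R ^ (k + 1)) :=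
    fun R hR => blowUpLimit_ball_le hlam hlam0 hv hup hR
  have hone : ∀ z ∈ ν.support, z ∈ Wᗮ → ∀ α : ℝ≥0,
      ν.restrict {x | dist (Wᗮ.starProjection x) z < δ z} =
        (α : ℝ≥0∞) • (μHE[k + 1] : Measure V).restrict {x | x - z ∈ W} → 1 ≤ α := by
    intro z hz hzW α hα
    have hα0 : α ≠ 0 := Measure.smul_restrict_slab_ne_zero hz hzW (hδ z) hα
    exact one_le_sheetMultiplicity hξ hT hlam hlam0 hv hLeb W hdim e hc₀ hM (hproj W hdim) hzW (hδ z)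
      hα0 hα
  have hZ : ∀ z ∈ ν.support, z ∈ Wᗮ → z = 0 := by
    intro z hz hzW
    by_contra hne
    obtain ⟨α₀, hα₀⟩ := hslab 0 (Submodule.zero_mem _)
    obtain ⟨αz, hαz⟩ := hslab z hzW
    set Z₀ : Finset V := {0, z} with hZ₀
    set αf : V → ℝ≥0 := fun w => if w = 0 then α₀ else αz with hαf
    have hsum := sum_sheetMultiplicity_le_one (ν := ν) W hdim Z₀
      (fun w hw => by
        rcases Finset.mem_insert.1 hw with rfl | hw
        · exact Submodule.zero_mem _
        · rw [Finset.mem_singleton.1 hw]; exact hzW)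
      δ (fun w _ => hδ w) αf
      (fun w hw => by
        rcases Finset.mem_insert.1 hw with rfl | hw
        · simp only [hαf, if_true]; exact hα₀
        · rw [Finset.mem_singleton.1 hw]; simp only [hαf, if_neg hne]; exact hαz)
      hgrowth
    rw [hZ₀, Finset.sum_insert (by simp [Ne.symm hne]), Finset.sum_singleton] at hsum
    simp only [hαf, if_true, if_neg hne] at hsum
    have h1 := hone 0 h0spt (Submodule.zero_mem _) α₀ hα₀
    have h2 := hone z hz hzW αz hαz
    have : (2 : ℝ≥0) ≤ 1 := by
      calc (2 : ℝ≥0) = 1 + 1 := by norm_num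
        _ ≤ α₀ + αz := add_le_add h1 h2
        _ ≤ 1 := hsum
    exact absurd this (by norm_num)
  -- (5) `α_0 = 1` and `ν = 𝓗^{k+1} ⌞ W`
  obtain ⟨α₀, hα₀⟩ := hslab 0 (Submodule.zero_mem _)
  have hα₀1 : α₀ = 1 := by
    refine le_antisymm ?_ (hone 0 h0spt (Submodule.zero_mem _) α₀ hα₀)
    have hsum := sum_sheetMultiplicity_le_one (ν := ν) W hdim {0}
      (fun w hw => by rw [Finset.mem_singleton.1 hw]; exact Submodule.zero_mem _)
      δ (fun w _ => hδ w) (fun _ => α₀)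
      (fun w hw => by rw [Finset.mem_singleton.1 hw]; exact hα₀) hgrowth
    rwa [Finset.sum_singleton] at hsum
  rw [hα₀1, ENNReal.coe_one, one_smul] at hα₀
  -- `spt ν ⊆ W ⊆ slab_0`
  have hsptW : ν.support ⊆ (W : Set V) := by
    intro x hx
    have hPx := hZ _ (Measure.starProjection_orthogonal_mem_support hinv hx)
      (Submodule.starProjection_apply_mem Wᗮ x)
    have hx' : x = W.starProjection x + Wᗮ.starProjection x :=
      (Submodule.starProjection_add_starProjection_orthogonal (K := W) x).symm
    rw [hPx, add_zero] at hx'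
    rw [hx']
    exact Submodule.starProjection_apply_mem W x
  have hslab0 : (W : Set V) ⊆ {x | dist (Wᗮ.starProjection x) 0 < δ 0} := by
    intro x hx
    change dist (Wᗮ.starProjection x) 0 < δ 0
    rw [Submodule.starProjection_orthogonal_apply_eq_zero hx, dist_self]
    exact hδ 0
  have hνS : ν {x | dist (Wᗮ.starProjection x) 0 < δ 0}ᶜ = 0 :=
    measure_mono_null (compl_subset_compl.2 (hsptW.trans hslab0)) Measure.measure_compl_support
  calc ν = ν.restrict {x | dist (Wᗮ.starProjection x) 0 < δ 0} :=
        (Measure.restrict_eq_self_of_ae_mem (by rw [ae_iff]; exact hνS)).symm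
    _ = (μHE[k + 1] : Measure V).restrict {x : V | x - 0 ∈ W} := hα₀
    _ = (μHE[k + 1] : Measure V).restrict W := by simp

/-- **Every sequence of scales has a subsequence along which the blow-ups converge to
`𝓗^{k+1} ⌞ W_{ξ(a)}`** (compactness `exists_subseq_vagueTendsto_blowUp` + uniqueness of the limit).
[cite: White1989, p. 220; Bandara2006, p. 44] -/
theorem exists_subseq_vagueTendsto_restrict_invariantSubspace (hξ : Integrable ξ σ)
    (hT : (vectorCurrent σ ξ : Current (⊤ : Opens V) (k + 1)).boundary = 0)
    {M : Set V} (hM : σ Mᶜ = 0)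
    (hproj : ∀ W : Submodule ℝ V, Module.finrank ℝ W = k + 1 →
      ∀ A ⊆ M, (μHE[k + 1] : Measure V) (W.starProjection '' A) ≤ σ A)
    (hLeb : Tendsto (fun r => (r⁻¹) ^ (k + 1) * ∫ x in closedBall a r, ‖ξ x - ξ a‖ ∂σ)
      (𝓝[>] 0) (𝓝 0))
    {M' : Set V} {β r₁ : ℝ} (hβ : 0 < β) (hr₁ : 0 < r₁) (haM' : a ∈ M')
    (hM' : ∀ x ∈ M', ∀ r, 0 < r → r ≤ r₁ → (β * r) ^ (k + 1) ≤ ∫ x' in closedBall x r, ‖ξ x'‖ ∂σ)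
    (hdens : Tendsto (fun r => (r⁻¹) ^ (k + 1) * (σ (closedBall a r \ M')).toReal)
      (𝓝[>] 0) (𝓝 0))
    (hξa : ξ a ≠ 0) {K : ℝ≥0∞} (hK : K ≠ ⊤)
    (hgrowthσ : ∀ s : ℝ, 0 < s → σ (closedBall a s) ≤ K * ENNReal.ofReal (s ^ (k + 1)))
    (hup : ∀ t : ℝ≥0∞, 1 < t → ∀ᶠ r in 𝓝[>] (0 : ℝ),
      σ (closedBall a r) ≤ t * (unitBallVolume (k + 1) * ENNReal.ofReal (r ^ (k + 1))))
    {r : ℕ → ℝ} (hr : ∀ l, 0 < r l) (hr0 : Tendsto r atTop (𝓝 0)) :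
    ∃ ι : ℕ → ℕ, StrictMono ι ∧
      Measure.VagueTendsto (fun l => Measure.blowUp σ (k + 1) a (r (ι l)))
        ((μHE[k + 1] : Measure V).restrict (ξ a).invariantSubspace) := by
  obtain ⟨ι, ν, hι, hν, hv⟩ := Measure.exists_subseq_vagueTendsto_blowUp σ (m := k + 1) hK hgrowthσ hr
  haveI := hν
  have h := (blowUpLimit_eq_restrict_invariantSubspace hξ hT hM hproj (lam := fun l => r (ι l))
    (fun l => hr _) (hr0.comp hι.tendsto_atTop) hv hLeb hβ hr₁ haM' hM' hdens hξa hup).2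
  exact ⟨ι, hι, h ▸ hv⟩

/-- **The blow-ups converge**: at a good point, for EVERY sequence `λ_l ↓ 0` the blow-ups
`σ_{a,λ_l}` converge vaguely to `𝓗^{k+1} ⌞ W_{ξ(a)}` ("`P` is independent of the subsequence `Λ`";
subsequence principle). [cite: White1989, p. 220; Bandara2006, pp. 44–45] -/
theorem vagueTendsto_blowUp_of_good (hξ : Integrable ξ σ)
    (hT : (vectorCurrent σ ξ : Current (⊤ : Opens V) (k + 1)).boundary = 0)
    {M : Set V} (hM : σ Mᶜ = 0)
    (hproj : ∀ W : Submodule ℝ V, Module.finrank ℝ W = k + 1 →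
      ∀ A ⊆ M, (μHE[k + 1] : Measure V) (W.starProjection '' A) ≤ σ A)
    (hLeb : Tendsto (fun r => (r⁻¹) ^ (k + 1) * ∫ x in closedBall a r, ‖ξ x - ξ a‖ ∂σ)
      (𝓝[>] 0) (𝓝 0))
    {M' : Set V} {β r₁ : ℝ} (hβ : 0 < β) (hr₁ : 0 < r₁) (haM' : a ∈ M')
    (hM' : ∀ x ∈ M', ∀ r, 0 < r → r ≤ r₁ → (β * r) ^ (k + 1) ≤ ∫ x' in closedBall x r, ‖ξ x'‖ ∂σ)
    (hdens : Tendsto (fun r => (r⁻¹) ^ (k + 1) * (σ (closedBall a r \ M')).toReal)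
      (𝓝[>] 0) (𝓝 0))
    (hξa : ξ a ≠ 0) {K : ℝ≥0∞} (hK : K ≠ ⊤)
    (hgrowthσ : ∀ s : ℝ, 0 < s → σ (closedBall a s) ≤ K * ENNReal.ofReal (s ^ (k + 1)))
    (hup : ∀ t : ℝ≥0∞, 1 < t → ∀ᶠ r in 𝓝[>] (0 : ℝ),
      σ (closedBall a r) ≤ t * (unitBallVolume (k + 1) * ENNReal.ofReal (r ^ (k + 1))))
    (hlam : ∀ l, 0 < lam l) (hlam0 : Tendsto lam atTop (𝓝 0)) :
    Measure.VagueTendsto (fun l => Measure.blowUp σ (k + 1) a (lam l))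
      ((μHE[k + 1] : Measure V).restrict (ξ a).invariantSubspace) := by
  intro g hg hgc
  refine tendsto_of_subseq_tendsto fun ns hns => ?_
  obtain ⟨ι, -, hv⟩ := exists_subseq_vagueTendsto_restrict_invariantSubspace hξ hT hM hproj hLeb hβ
    hr₁ haM' hM' hdens hξa hK hgrowthσ hup (r := fun n => lam (ns n)) (fun n => hlam _)
    (hlam0.comp hns)
  exact ⟨ι, hv g hg hgc⟩

omit [FiniteDimensional ℝ V] [MeasurableSpace V] [BorelSpace V] in
/-- The dilation `y ↦ a + r y` maps the cone-complement piece
`C_s = {‖y‖ ≤ 1, s‖y‖ ≤ ‖P_{Wᗮ} y‖}` onto `{‖x − a‖ ≤ r, s‖x − a‖ ≤ ‖P_{Wᗮ}(x − a)‖}`.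
[cite: Mattila1995, 15.12] -/
theorem image_add_smul_coneCompl (W : Submodule ℝ V) [Wᗮ.HasOrthogonalProjection] (a : V)
    {r : ℝ} (hr : 0 < r) (s : ℝ) :
    (fun y : V => a + r • y) '' {y : V | ‖y‖ ≤ 1 ∧ s * ‖y‖ ≤ ‖Wᗮ.starProjection y‖} =
      {x : V | ‖x - a‖ ≤ r ∧ s * ‖x - a‖ ≤ ‖Wᗮ.starProjection (x - a)‖} := by
  ext x
  constructor
  · rintro ⟨y, ⟨hy1, hy2⟩, rfl⟩
    refine ⟨?_, ?_⟩
    · rw [add_sub_cancel_left, norm_smul, Real.norm_of_nonneg hr.le]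
      exact mul_le_of_le_one_right hr.le hy1
    · rw [add_sub_cancel_left, map_smul, norm_smul, norm_smul, Real.norm_of_nonneg hr.le,
        mul_left_comm]
      exact mul_le_mul_of_nonneg_left hy2 hr.le
  · rintro ⟨hx1, hx2⟩
    refine ⟨r⁻¹ • (x - a), ⟨?_, ?_⟩, ?_⟩
    · rw [norm_smul, Real.norm_of_nonneg (inv_nonneg.2 hr.le)]
      exact (inv_mul_le_iff₀ hr).2 (by simpa using hx1)
    · rw [map_smul, norm_smul, norm_smul, Real.norm_of_nonneg (inv_nonneg.2 hr.le), mul_left_comm]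
      exact mul_le_mul_of_nonneg_left hx2 (inv_nonneg.2 hr.le)
    · simp only [smul_smul, mul_inv_cancel₀ hr.ne', one_smul, add_sub_cancel]

/-- **The approximate tangent plane property at a good point**: for every `s > 0`,
`r^{-(k+1)} σ{x ∈ 𝐁(a, r) : s‖x − a‖ ≤ ‖P_{Wᗮ}(x − a)‖} → 0` as `r ↓ 0` (`W = W_{ξ(a)}`): the part
of `σ` outside the cone `X(a, W, s)` has `(k+1)`-density zero at `a` (the blow-ups converge to
`𝓗^{k+1} ⌞ W`, which gives no mass to the compact set `C_s` meeting `W` only at `0`).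
[cite: White1989, p. 220; Mattila1995, 15.19] -/
theorem tendsto_blowUp_coneCompl_of_good (hξ : Integrable ξ σ)
    (hT : (vectorCurrent σ ξ : Current (⊤ : Opens V) (k + 1)).boundary = 0)
    {M : Set V} (hM : σ Mᶜ = 0)
    (hproj : ∀ W : Submodule ℝ V, Module.finrank ℝ W = k + 1 →
      ∀ A ⊆ M, (μHE[k + 1] : Measure V) (W.starProjection '' A) ≤ σ A)
    (hLeb : Tendsto (fun r => (r⁻¹) ^ (k + 1) * ∫ x in closedBall a r, ‖ξ x - ξ a‖ ∂σ)
      (𝓝[>] 0) (𝓝 0))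
    {M' : Set V} {β r₁ : ℝ} (hβ : 0 < β) (hr₁ : 0 < r₁) (haM' : a ∈ M')
    (hM' : ∀ x ∈ M', ∀ r, 0 < r → r ≤ r₁ → (β * r) ^ (k + 1) ≤ ∫ x' in closedBall x r, ‖ξ x'‖ ∂σ)
    (hdens : Tendsto (fun r => (r⁻¹) ^ (k + 1) * (σ (closedBall a r \ M')).toReal)
      (𝓝[>] 0) (𝓝 0))
    (hξa : ξ a ≠ 0) {K : ℝ≥0∞} (hK : K ≠ ⊤)
    (hgrowthσ : ∀ s : ℝ, 0 < s → σ (closedBall a s) ≤ K * ENNReal.ofReal (s ^ (k + 1)))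
    (hup : ∀ t : ℝ≥0∞, 1 < t → ∀ᶠ r in 𝓝[>] (0 : ℝ),
      σ (closedBall a r) ≤ t * (unitBallVolume (k + 1) * ENNReal.ofReal (r ^ (k + 1))))
    {s : ℝ} (hs : 0 < s) :
    Tendsto (fun r : ℝ => ENNReal.ofReal ((r⁻¹) ^ (k + 1)) *
      σ {x : V | ‖x - a‖ ≤ r ∧ s * ‖x - a‖ ≤ ‖((ξ a).invariantSubspace)ᗮ.starProjection (x - a)‖})
      (𝓝[>] 0) (𝓝 0) := by
  set W := (ξ a).invariantSubspace with hWdef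
  set C : Set V := {y : V | ‖y‖ ≤ 1 ∧ s * ‖y‖ ≤ ‖Wᗮ.starProjection y‖} with hC
  -- the dimension (from any blow-up limit) and local finiteness of the limit measure
  obtain ⟨ι₀, ν₀, hι₀, hν₀, hv₀⟩ := Measure.exists_subseq_vagueTendsto_blowUp σ (m := k + 1) hK hgrowthσ
    (r := fun n : ℕ => ((n : ℝ) + 1)⁻¹) (fun n => by positivity)
  haveI := hν₀
  have hdim : Module.finrank ℝ W = k + 1 :=
    (blowUpLimit_eq_restrict_invariantSubspace hξ hT hM hproj (lam := fun l => ((ι₀ l : ℝ) + 1)⁻¹)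
      (fun l => by positivity)
      ((tendsto_one_div_add_atTop_nhds_zero_nat.congr fun n => one_div _).comp hι₀.tendsto_atTop)
      hv₀ hLeb hβ hr₁ haM' hM' hdens hξa hup).1
  haveI : IsLocallyFiniteMeasure ((μHE[k + 1] : Measure V).restrict W) :=
    isLocallyFiniteMeasure_restrict_submodule W hdim
  have hCc : IsCompact C := by
    refine Metric.isCompact_of_isClosed_isBounded ?_ ?_
    · exact (isClosed_le continuous_norm continuous_const).inter
        (isClosed_le (continuous_const.mul continuous_norm) (Wᗮ.starProjection.continuous.norm))
    · exact (isBounded_iff_forall_norm_le.2 ⟨1, fun y hy => hy.1⟩)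
  -- the limit measure gives no mass to `C`
  have hC0 : (μHE[k + 1] : Measure V).restrict W C = 0 := by
    rw [Measure.restrict_apply hCc.isClosed.measurableSet]
    have hsub : C ∩ (W : Set V) ⊆ {(0 : V)} := by
      rintro y ⟨⟨-, hy2⟩, hyW⟩
      rw [Submodule.starProjection_orthogonal_apply_eq_zero hyW, norm_zero] at hy2
      have : ‖y‖ ≤ 0 := by
        by_contra h
        exact absurd hy2 (not_le.2 (mul_pos hs (not_le.1 h)))
      exact mem_singleton_iff.2 (norm_le_zero_iff.1 this)
    refine measure_mono_null hsub ?_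
    haveI := Measure.nullSingletonClass_hausdorff (X := V) (d := (k + 1 : ℕ))
      (by exact_mod_cast Nat.succ_pos k)
    rw [Measure.euclideanHausdorffMeasure_def, Measure.smul_apply, measure_singleton, smul_zero]
  -- the blow-ups rewrite the quantity in question
  have hrew : ∀ r : ℝ, 0 < r → ENNReal.ofReal ((r⁻¹) ^ (k + 1)) *
      σ {x : V | ‖x - a‖ ≤ r ∧ s * ‖x - a‖ ≤ ‖Wᗮ.starProjection (x - a)‖} =
      Measure.blowUp σ (k + 1) a r C := by
    intro r hr
    rw [Measure.blowUp_apply σ (k + 1) a hr, hC, image_add_smul_coneCompl W a hr s]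
  -- sequential criterion
  refine (tendsto_iff_seq_tendsto (f := fun r : ℝ => ENNReal.ofReal ((r⁻¹) ^ (k + 1)) *
      σ {x : V | ‖x - a‖ ≤ r ∧ s * ‖x - a‖ ≤ ‖Wᗮ.starProjection (x - a)‖})
    (k := 𝓝[>] (0 : ℝ)) (l := 𝓝 0)).2 fun x hx => ?_
  rw [tendsto_nhdsWithin_iff] at hx
  obtain ⟨hx0, hxpos⟩ := hx
  obtain ⟨N, hN⟩ := eventually_atTop.1 hxpos
  rw [← tendsto_add_atTop_iff_nat N]
  set lam' : ℕ → ℝ := fun n => x (n + N) with hlam'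
  have hlam' : ∀ n, 0 < lam' n := fun n => hN _ (Nat.le_add_left N n)
  have hlam'0 : Tendsto lam' atTop (𝓝 0) := hx0.comp (tendsto_add_atTop_nat N)
  have heq : (fun n => ENNReal.ofReal (((x (n + N))⁻¹) ^ (k + 1)) *
      σ {y : V | ‖y - a‖ ≤ x (n + N) ∧ s * ‖y - a‖ ≤ ‖Wᗮ.starProjection (y - a)‖}) =
      fun n => Measure.blowUp σ (k + 1) a (lam' n) C := funext fun n => hrew _ (hlam' n)
  rw [show (fun n => ((fun r : ℝ => ENNReal.ofReal ((r⁻¹) ^ (k + 1)) *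
      σ {y : V | ‖y - a‖ ≤ r ∧ s * ‖y - a‖ ≤ ‖Wᗮ.starProjection (y - a)‖}) ∘ x) (n + N)) =
      fun n => Measure.blowUp σ (k + 1) a (lam' n) C from heq]
  refine tendsto_of_subseq_tendsto fun ns hns => ?_
  obtain ⟨ι, hι, hv⟩ := exists_subseq_vagueTendsto_restrict_invariantSubspace hξ hT hM hproj hLeb hβ
    hr₁ haM' hM' hdens hξa hK hgrowthσ hup (r := fun n => lam' (ns n)) (fun n => hlam' _)
    (hlam'0.comp hns)
  refine ⟨ι, ?_⟩
  have hls := hv.limsup_measure_le_of_isCompact hCc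
  rw [hC0] at hls
  exact tendsto_of_le_liminf_of_limsup_le (by simp) hls

end Unique

end Literature.Geometry.GeometricMeasureTheory
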